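import Literature.Geometry.Symplectic.PfaffianFour
import Mathlib.Analysis.InnerProductSpace.PiL2
import Mathlib.Analysis.Calculus.ContDiff.WithLp
import HarnessLib

/-!
# Left quaternion multiplication on `ℝ⁴`: an orthogonal frame with prescribed first vector

Topic `Literature/Geometry/Symplectic` (groundwork `--supports`
`Literature.Geometry.Symplectic.relNearSymplecticTaubesTubes_exists`; everything here is PROVED,
no named fact is introduced).

Identify `ℝ⁴ = ℍ` through the basis `1, i, j, k`.  Left multiplication by `u ∈ ℍ`,
`L_u v = u · v`, is linear in `v`, satisfies `L_u(1) = u` and `⟪L_u v, L_u w⟫ = |u|² ⟪v, w⟫`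
(the quaternion norm is multiplicative), and depends polynomially on `(u, v)`.  Hence for a unit
vector `u` the columns `L_u(1) = u, L_u(i), L_u(j), L_u(k)` form an ORTHONORMAL FRAME OF `ℝ⁴`
WITH PRESCRIBED FIRST VECTOR `u`, depending smoothly (indeed linearly) on `u` — the device used
to complete the unit tangent field of a curve in a `4`-manifold, expressed in a parallel
orthonormal frame, to a smooth orthonormal frame (tubular neighbourhoods of zero circles,
Honda 2004, §4 / Perutz 2006, §3; cf. `SelfDualTripleFrame.lean` for the dual picture on
`2`-forms).  Standard quaternion algebra (Conway–Smith, *On Quaternions and Octonions* (2003),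
§2; McDuff–Salamon 2017, §2.1 for `ℝ⁴ = ℍ` conventions in symplectic geometry).

* `quatLeftMul u v` and its coordinates; `quatLeftMul_stdVec_zero : L_u e₀ = u`;
* linearity in each variable; `inner_quatLeftMul : ⟪L_u v, L_u w⟫ = ‖u‖² ⟪v, w⟫`,
  `norm_quatLeftMul : ‖L_u v‖ = ‖u‖ ‖v‖`, `quatLeftMul_injective`;
* `inner_quatLeftMul_stdVec` — for `‖u‖ = 1` the frame `(L_u e_a)_a` is orthonormal;
* `contDiff_quatLeftMul` — `(u, v) ↦ L_u v` is `C^∞`.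

## References

* D. McDuff, D. Salamon, *Introduction to Symplectic Topology*, 3rd ed. (2017), §2.1
  [McDuffSalamon2017].
-/

noncomputable section

open scoped RealInnerProductSpace ContDiff
open Module

namespace Literature.Geometry.Symplectic

/-- Local notation for the model space `ℝ⁴ = EuclideanSpace ℝ (Fin 4)`. -/
local notation "E4" => EuclideanSpace ℝ (Fin 4)

/-- **Left quaternion multiplication** `L_u v = u · v` on `ℝ⁴ = ℍ` (coordinates `0, 1, 2, 3` =
`1, i, j, k`). [cite: McDuffSalamon2017, §2.1] -/
def quatLeftMul (u v : E4) : E4 :=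
  WithLp.toLp 2
    ![u 0 * v 0 - u 1 * v 1 - u 2 * v 2 - u 3 * v 3,
      u 0 * v 1 + u 1 * v 0 + u 2 * v 3 - u 3 * v 2,
      u 0 * v 2 - u 1 * v 3 + u 2 * v 0 + u 3 * v 1,
      u 0 * v 3 + u 1 * v 2 - u 2 * v 1 + u 3 * v 0]

/-- Real part of `u · v`. [folklore] -/
@[simp] theorem quatLeftMul_apply_zero (u v : E4) :
    quatLeftMul u v 0 = u 0 * v 0 - u 1 * v 1 - u 2 * v 2 - u 3 * v 3 := rfl

/-- `i`-part of `u · v`. [folklore] -/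
@[simp] theorem quatLeftMul_apply_one (u v : E4) :
    quatLeftMul u v 1 = u 0 * v 1 + u 1 * v 0 + u 2 * v 3 - u 3 * v 2 := rfl

/-- `j`-part of `u · v`. [folklore] -/
@[simp] theorem quatLeftMul_apply_two (u v : E4) :
    quatLeftMul u v 2 = u 0 * v 2 - u 1 * v 3 + u 2 * v 0 + u 3 * v 1 := rfl

/-- `k`-part of `u · v`. [folklore] -/
@[simp] theorem quatLeftMul_apply_three (u v : E4) :
    quatLeftMul u v 3 = u 0 * v 3 + u 1 * v 2 - u 2 * v 1 + u 3 * v 0 := rfl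

/-- **`L_u(1) = u`**: the first frame vector is prescribed. [folklore] -/
@[simp] theorem quatLeftMul_stdVec_zero (u : E4) : quatLeftMul u (stdVec 0) = u := by
  ext i
  fin_cases i <;> simp

/-- `L_u` is additive. [folklore] -/
theorem quatLeftMul_add_right (u v w : E4) :
    quatLeftMul u (v + w) = quatLeftMul u v + quatLeftMul u w := by
  ext i
  fin_cases i <;> simp <;> ring

/-- `L_u` is homogeneous. [folklore] -/
theorem quatLeftMul_smul_right (u : E4) (c : ℝ) (v : E4) :
    quatLeftMul u (c • v) = c • quatLeftMul u v := by
  ext i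
  fin_cases i <;> simp <;> ring

/-- `u ↦ L_u v` is additive. [folklore] -/
theorem quatLeftMul_add_left (u u' v : E4) :
    quatLeftMul (u + u') v = quatLeftMul u v + quatLeftMul u' v := by
  ext i
  fin_cases i <;> simp <;> ring

/-- `u ↦ L_u v` is homogeneous. [folklore] -/
theorem quatLeftMul_smul_left (c : ℝ) (u v : E4) :
    quatLeftMul (c • u) v = c • quatLeftMul u v := by
  ext i
  fin_cases i <;> simp <;> ring

/-- `L_u` on finite combinations. [folklore] -/
theorem quatLeftMul_sum_smul_right {ι : Type*} (s : Finset ι) (u : E4) (c : ι → ℝ)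
    (v : ι → E4) : quatLeftMul u (∑ a ∈ s, c a • v a) = ∑ a ∈ s, c a • quatLeftMul u (v a) := by
  classical
  induction s using Finset.induction_on with
  | empty =>
    ext i
    fin_cases i <;> simp
  | insert a s ha ih =>
    rw [Finset.sum_insert ha, Finset.sum_insert ha, quatLeftMul_add_right, quatLeftMul_smul_right,
      ih]

/-- **The quaternion norm is multiplicative, polarised**: `⟪L_u v, L_u w⟫ = ‖u‖² ⟪v, w⟫`.
[cite: McDuffSalamon2017, §2.1] -/
theorem inner_quatLeftMul (u v w : E4) :
    ⟪quatLeftMul u v, quatLeftMul u w⟫ = ‖u‖ ^ 2 * ⟪v, w⟫ := by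
  simp only [PiLp.inner_apply, EuclideanSpace.real_norm_sq_eq, Fin.sum_univ_four,
    RCLike.inner_apply, conj_trivial, quatLeftMul_apply_zero, quatLeftMul_apply_one,
    quatLeftMul_apply_two, quatLeftMul_apply_three]
  ring

/-- `‖L_u v‖ = ‖u‖ ‖v‖`. [cite: McDuffSalamon2017, §2.1] -/
theorem norm_quatLeftMul (u v : E4) : ‖quatLeftMul u v‖ = ‖u‖ * ‖v‖ := by
  have h := inner_quatLeftMul u v v
  rw [real_inner_self_eq_norm_sq, real_inner_self_eq_norm_sq] at h
  have h2 : ‖quatLeftMul u v‖ ^ 2 = (‖u‖ * ‖v‖) ^ 2 := by rw [h]; ring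
  exact (sq_eq_sq₀ (norm_nonneg _) (mul_nonneg (norm_nonneg _) (norm_nonneg _))).1 h2

/-- `L_u` is injective for `u ≠ 0` (`ℍ` is a division algebra). [folklore] -/
theorem quatLeftMul_injective {u : E4} (hu : u ≠ 0) : Function.Injective (quatLeftMul u) := by
  intro v w h
  have h0 : quatLeftMul u (v - w) = 0 := by
    rw [sub_eq_add_neg, quatLeftMul_add_right, ← neg_one_smul ℝ w, quatLeftMul_smul_right, h]
    simp
  have h1 : ‖u‖ * ‖v - w‖ = 0 := by rw [← norm_quatLeftMul, h0, norm_zero]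
  rcases mul_eq_zero.1 h1 with h2 | h2
  · exact absurd (norm_eq_zero.1 h2) hu
  · exact sub_eq_zero.1 (norm_eq_zero.1 h2)

/-- **For a unit quaternion the frame `L_u e₀ = u, L_u e₁, L_u e₂, L_u e₃` is orthonormal.**
[cite: McDuffSalamon2017, §2.1] -/
theorem inner_quatLeftMul_stdVec {u : E4} (hu : ‖u‖ = 1) (a b : Fin 4) :
    ⟪quatLeftMul u (stdVec a), quatLeftMul u (stdVec b)⟫ = if a = b then 1 else 0 := by
  rw [inner_quatLeftMul, hu, one_pow, one_mul]
  change ⟪EuclideanSpace.single a (1 : ℝ), stdVec b⟫ = _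
  rw [EuclideanSpace.inner_single_left, stdVec_apply]
  simp

/-- In particular `L_u e_a ⊥ u` for `a ≠ 0` (for any `u`). [folklore] -/
theorem inner_quatLeftMul_stdVec_self (u : E4) {a : Fin 4} (ha : a ≠ 0) :
    ⟪quatLeftMul u (stdVec a), u⟫ = 0 := by
  have h := inner_quatLeftMul u (stdVec a) (stdVec 0)
  rw [quatLeftMul_stdVec_zero] at h
  rw [h]
  change ‖u‖ ^ 2 * ⟪EuclideanSpace.single a (1 : ℝ), stdVec 0⟫ = 0
  rw [EuclideanSpace.inner_single_left, stdVec_apply]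
  simp [ha]

/-- **`(u, v) ↦ L_u v` is `C^∞`** (polynomial coordinates). [folklore] -/
theorem contDiff_quatLeftMul : ContDiff ℝ ∞ (fun p : E4 × E4 => quatLeftMul p.1 p.2) := by
  rw [contDiff_euclidean]
  have hc : ∀ i : Fin 4, ContDiff ℝ ∞ (fun p : E4 × E4 => p.1 i) ∧
      ContDiff ℝ ∞ (fun p : E4 × E4 => p.2 i) := fun i =>
    ⟨(contDiff_euclidean.1 contDiff_fst) i, (contDiff_euclidean.1 contDiff_snd) i⟩
  intro i
  fin_cases i
  · simp only [Fin.zero_eta, Fin.isValue, quatLeftMul_apply_zero]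
    exact (((hc 0).1.mul (hc 0).2).sub ((hc 1).1.mul (hc 1).2)).sub ((hc 2).1.mul (hc 2).2)
      |>.sub ((hc 3).1.mul (hc 3).2)
  · simp only [Fin.mk_one, Fin.isValue, quatLeftMul_apply_one]
    exact (((hc 0).1.mul (hc 1).2).add ((hc 1).1.mul (hc 0).2)).add ((hc 2).1.mul (hc 3).2)
      |>.sub ((hc 3).1.mul (hc 2).2)
  · simp only [Fin.reduceFinMk, Fin.isValue, quatLeftMul_apply_two]
    exact (((hc 0).1.mul (hc 2).2).sub ((hc 1).1.mul (hc 3).2)).add ((hc 2).1.mul (hc 0).2)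
      |>.add ((hc 3).1.mul (hc 1).2)
  · simp only [Fin.reduceFinMk, Fin.isValue, quatLeftMul_apply_three]
    exact (((hc 0).1.mul (hc 3).2).add ((hc 1).1.mul (hc 2).2)).sub ((hc 2).1.mul (hc 1).2)
      |>.add ((hc 3).1.mul (hc 0).2)

/-- `u ↦ L_u v` is `C^∞` for fixed `v`, and `v ↦ L_u v` for fixed `u`. [folklore] -/
theorem contDiff_quatLeftMul_left (v : E4) : ContDiff ℝ ∞ (fun u : E4 => quatLeftMul u v) :=
  contDiff_quatLeftMul.comp (contDiff_id.prodMk contDiff_const)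

end Literature.Geometry.Symplectic

end
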